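import Literature.Computability.QuantumComplexity.ShallowCircuitsRing
import HarnessLib

/-!
# Cell qa-qnc0 (rung F-Q1 → F-Q1-exp / F-Q1⁺): `LongGridCycle` — grid cycles of length `≥ N²/4`

Planner qa-qnc0-p2 g12, ROUND-12 sketch `Sketch12b.lean` §3, statement **E3 `LongGridCycle` VERBATIM**:
for all large `N` the `N × N` grid (`gridGraph N = pathGraph N □ pathGraph N`) carries a cycle
(tree structure `GridCycle N n`: an injective map `Fin n → Fin N × Fin N` with cyclically consecutive
positions grid-adjacent) of length `n` with `N² ≤ 4n`.  The square cycle `GridCycle.square t` (length `8t ≈ 4N`)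
used by `RingFrameBridge` is too short for the exponential-size bridges of ROUND-12 (§4 `HLFNotFAC0ModExp`,
`HLFNotGC0ModExp`), whose degree budget `√n` must be `Ω(N)`.

Construction (the planner's PLAN): the boustrophedon Hamiltonian cycle of the `M × M` sub-grid, `M = 2⌊N/2⌋`:
positions `k < M(M-1)` snake through the columns `1 … M-1` row by row (row `q = ⌊k/(M-1)⌋`, left → right on even
rows, right → left on odd rows), positions `M(M-1) ≤ k < M²` return up column `0` from row `M-1` to row `0`;
`n = M² ≥ (N-1)² ≥ N²/4` for `N ≥ 2`.  Explicit position map (`Boustrophedon.row/col`), injectivity by the case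
analysis column `= 0` / `≥ 1`, adjacency by the four successor cases; no search.

WHAT THIS IS NOT: no hardness statement; nothing on α; the bridges P3/P4 of Sketch12b are separate tasks;
separation NOT moved.
-/

namespace Summit.QuantumAdvantage.AdviceFreeQNC0

open Finset
open Literature.Computability.QuantumComplexity

/-- **E3 `LongGridCycle`** (qa-qnc0-p2 Sketch12b §3, verbatim) — for all large `N` the `N × N` grid contains a
cycle (tree structure `GridCycle N n`: injective, cyclically adjacent) of length `n ≥ N²/4`. -/
def LongGridCycle : Prop :=
  ∃ N₁ : ℕ, ∀ N ≥ N₁, ∃ n : ℕ, N * N ≤ 4 * n ∧ Nonempty (GridCycle N n)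

namespace Boustrophedon

/-- Row of position `k` of the boustrophedon cycle of the `M × M` grid: the snake part `k < M(M-1)` lies in
row `⌊k/(M-1)⌋`, the return part `M(M-1) ≤ k < M²` in row `M² - 1 - k` of column `0`. -/
def row (M k : ℕ) : ℕ := if k < M * (M - 1) then k / (M - 1) else M * M - 1 - k

/-- Column of position `k` of the boustrophedon cycle of the `M × M` grid: in the snake part the offset
`j = k mod (M-1)` is read left → right (`j + 1`) on even rows and right → left (`M - 1 - j`) on odd rows;
the return part is column `0`. -/
def col (M k : ℕ) : ℕ :=
  if k < M * (M - 1) then (if k / (M - 1) % 2 = 0 then k % (M - 1) + 1 else M - 1 - k % (M - 1)) else 0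

variable {M : ℕ}

/-- `M(M-1) = (M-1)² + (M-1)`. -/
private theorem mul_pred_eq (hM : 1 ≤ M) : M * (M - 1) = (M - 1) * (M - 1) + (M - 1) := by
  obtain ⟨M', rfl⟩ : ∃ M', M = M' + 1 := ⟨M - 1, by omega⟩
  simp only [Nat.add_sub_cancel]
  ring

/-- `M² = M(M-1) + M`. -/
private theorem mul_self_eq (hM : 1 ≤ M) : M * M = M * (M - 1) + M := by
  obtain ⟨M', rfl⟩ : ∃ M', M = M' + 1 := ⟨M - 1, by omega⟩
  simp only [Nat.add_sub_cancel]
  ring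

/-- Successor inside a snake row: quotient unchanged, remainder `+ 1`. -/
private theorem div_mod_succ_of_lt {W k : ℕ} (h : k % W + 1 < W) :
    (k + 1) / W = k / W ∧ (k + 1) % W = k % W + 1 := by
  have hW : 0 < W := by omega
  have hk := Nat.div_add_mod k W
  exact (Nat.div_mod_unique hW).mpr ⟨by omega, h⟩

/-- Successor at the end of a snake row: quotient `+ 1`, remainder `0`. -/
private theorem div_mod_succ_of_eq {W k : ℕ} (h : k % W + 1 = W) :
    (k + 1) / W = k / W + 1 ∧ (k + 1) % W = 0 := by
  have hW : 0 < W := by omega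
  have hk := Nat.div_add_mod k W
  refine (Nat.div_mod_unique hW).mpr ⟨?_, hW⟩
  rw [Nat.mul_succ]
  omega

/-- The last snake position `M(M-1) - 1` lies in row `M - 1` at offset `M - 2`. -/
private theorem div_mod_last (hM : 2 ≤ M) :
    (M * (M - 1) - 1) / (M - 1) = M - 1 ∧ (M * (M - 1) - 1) % (M - 1) = M - 2 := by
  have hW : 0 < M - 1 := by omega
  have hP := mul_pred_eq (M := M) (by omega)
  refine (Nat.div_mod_unique hW).mpr ⟨?_, by omega⟩
  omega

/-- Rows are `< M`. -/
theorem row_lt (hM : 2 ≤ M) {k : ℕ} (hk : k < M * M) : row M k < M := by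
  have hQ := mul_self_eq (M := M) (by omega)
  unfold row
  split_ifs with h
  · exact (Nat.div_lt_iff_lt_mul (by omega)).mpr h
  · omega

/-- Columns are `< M`. -/
theorem col_lt (hM : 2 ≤ M) {k : ℕ} (_hk : k < M * M) : col M k < M := by
  unfold col
  split_ifs with h
  · have := Nat.mod_lt k (show 0 < M - 1 by omega); omega
  · omega
  · omega

/-- Consecutive positions are grid neighbours. -/
theorem natAdj_succ (hM : 2 ≤ M) (hE : M % 2 = 0) {k : ℕ} (hk : k + 1 < M * M) :
    RectData.NatAdj (row M k) (col M k) (row M (k + 1)) (col M (k + 1)) := by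
  have hP := mul_pred_eq (M := M) (by omega)
  have hQ := mul_self_eq (M := M) (by omega)
  have hW : 0 < M - 1 := by omega
  unfold RectData.NatAdj row col
  by_cases h1 : k + 1 < M * (M - 1)
  · -- both positions in the snake part
    have h0 : k < M * (M - 1) := by omega
    have hj := Nat.mod_lt k hW
    simp only [h0, h1, if_true]
    by_cases hlt : k % (M - 1) + 1 < M - 1
    · obtain ⟨hd, hm⟩ := div_mod_succ_of_lt hlt
      rw [hd, hm]
      split_ifs <;> omega
    · obtain ⟨hd, hm⟩ := div_mod_succ_of_eq (W := M - 1) (k := k) (by omega)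
      rw [hd, hm]
      split_ifs <;> omega
  · by_cases h2 : k + 1 = M * (M - 1)
    · -- last snake position → first return position
      have hk' : k = M * (M - 1) - 1 := by omega
      subst hk'
      have h0 : M * (M - 1) - 1 < M * (M - 1) := by omega
      obtain ⟨hd, hm⟩ := div_mod_last hM
      have hodd : ¬ (M - 1) % 2 = 0 := by omega
      simp only [h0, h1, if_true, if_false, hd, hm, hodd]
      omega
    · -- both positions in the return column
      have h0 : ¬ k < M * (M - 1) := by omega
      simp only [h0, h1, if_false]
      exact Or.inr ⟨trivial, Or.inr (by omega)⟩

/-- The last position is a grid neighbour of the first. -/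
theorem natAdj_last (hM : 2 ≤ M) :
    RectData.NatAdj (row M (M * M - 1)) (col M (M * M - 1)) (row M 0) (col M 0) := by
  have hP := mul_pred_eq (M := M) (by omega)
  have hQ := mul_self_eq (M := M) (by omega)
  have h0 : 0 < M * (M - 1) := by omega
  have h1 : ¬ M * M - 1 < M * (M - 1) := by omega
  unfold RectData.NatAdj row col
  rw [if_neg h1, if_neg h1, if_pos h0, if_pos h0, Nat.zero_div, Nat.zero_mod,
    if_pos (show 0 % 2 = 0 from rfl)]
  exact Or.inl ⟨by omega, Or.inl rfl⟩

/-- The position map is injective on `k < M²`. -/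
theorem inj (hM : 2 ≤ M) {k k' : ℕ} (hk : k < M * M) (hk' : k' < M * M)
    (hr : row M k = row M k') (hc : col M k = col M k') : k = k' := by
  have hW : 0 < M - 1 := by omega
  have hj := Nat.mod_lt k hW
  have hj' := Nat.mod_lt k' hW
  have hd := Nat.div_add_mod k (M - 1)
  have hd' := Nat.div_add_mod k' (M - 1)
  unfold row at hr
  unfold col at hc
  by_cases h0 : k < M * (M - 1)
  · by_cases h0' : k' < M * (M - 1)
    · simp only [h0, h0', if_true] at hr hc
      rw [hr] at hd hc
      split_ifs at hc <;> omega
    · simp only [h0, h0', if_true, if_false] at hc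
      (split_ifs at hc; omega)
  · by_cases h0' : k' < M * (M - 1)
    · simp only [h0, h0', if_true, if_false] at hc
      (split_ifs at hc; omega)
    · simp only [h0, h0', if_false] at hr
      omega

/-- **The boustrophedon cycle**: a grid cycle of length `M²` through the `M × M` sub-grid of the `N × N` grid,
for `M ≥ 2` even and `M ≤ N`. -/
def cycle (M N : ℕ) (hM : 2 ≤ M) (hE : M % 2 = 0) (hN : M ≤ N) : GridCycle N (M * M) where
  toFun k := (⟨row M k, lt_of_lt_of_le (row_lt hM k.isLt) hN⟩, ⟨col M k, lt_of_lt_of_le (col_lt hM k.isLt) hN⟩)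
  injective := by
    intro k k' h
    have h1 : row M k = row M k' := congrArg (fun a => a.1.val) h
    have h2 : col M k = col M k' := congrArg (fun a => a.2.val) h
    exact Fin.ext (inj hM k.isLt k'.isLt h1 h2)
  adj k := by
    apply RectData.gridGraph_adj_of_natAdj
    simp only [RingHLF.nxt]
    by_cases hk : k.val + 1 < M * M
    · rw [Nat.mod_eq_of_lt hk]
      exact natAdj_succ hM hE hk
    · have hk' : k.val = M * M - 1 := by have := k.isLt; omega
      rw [show k.val + 1 = M * M by omega, Nat.mod_self, hk']
      exact natAdj_last hM

end Boustrophedon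

/-- **E3 `LongGridCycle` — PROVED** (`N₁ = 2`): for every `N ≥ 2` the boustrophedon cycle of the
`2⌊N/2⌋ × 2⌊N/2⌋` sub-grid is a grid cycle of length `n = 4⌊N/2⌋² ≥ (N-1)²`, and `N² ≤ 4n`. -/
theorem longGridCycle : LongGridCycle := by
  refine ⟨2, fun N hN => ⟨2 * (N / 2) * (2 * (N / 2)), ?_, ⟨Boustrophedon.cycle (2 * (N / 2)) N (by omega)
    (by omega) (by omega)⟩⟩⟩
  rcases Nat.even_or_odd' N with ⟨m, rfl | rfl⟩
  · rw [Nat.mul_div_cancel_left m (by norm_num)]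
    nlinarith
  · rw [show (2 * m + 1) / 2 = m by omega]
    nlinarith

end Summit.QuantumAdvantage.AdviceFreeQNC0
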